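import Literature.Analysis.FluidPDE.SelfSimilarEulerOutgoing
import Mathlib.Analysis.Analytic.Basic
import HarnessLib

/-!
# Constantin–Ignatova–Vicol 2026, Theorem 3.10: the local outgoing property with vorticity
# analytic at the stagnation points forces `γ ≥ ½`

Analysis/FluidPDE fact file: ONE named fact (`def … : Prop`, D-0014) with its precise locator,
plus proved companions. No `sorry`. Companion of `SelfSimilarEulerProfile.lean` (the vocabulary:
`IsSelfSimilarEulerProfile`, `selfSimilarTransport`, `selfSimilarNodalSet`, `IsLocallyOutgoing`,
`IsGloballyOutgoing`, `HasSelfSimilarFarField`) and of `SelfSimilarEulerOutgoing.lean`, where the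
sister statement **Theorem 3.8** (`γ ≥ ½ + c_*` when some stagnation point of the outgoing
transport field carries vorticity) is PROVED (`IsSelfSimilarEulerVorticityProfile.
half_add_le_of_isLocallyOutgoing`).

P. Constantin, M. Ignatova, V. Vicol, *On putative self-similarity for incompressible 3D Euler*
(arXiv:2602.17570, 2026), §3.5, treat the complementary case in which the vorticity profile
`Ω = ∇ × U` VANISHES at every stagnation point `y_* ∈ 𝒩_V` of `V = γ y + U`:

> **Proposition 3.9.** Let `U` be a `C²` smooth similarity profile solving (3.3). Let `y_*` be a
> zero of `V(y) = γ y + U(y)`. If `U` satisfies the outgoing property (3.37) locally near `y = y_*`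
> for some `c_* ≥ 0`, and if `γ < ½ + c_*`, then `Ω(y_*) = 0`. Additionally, for any `n ∈ ℕ` such
> that `Ω` is `C^{n+1}` smooth in an open neighborhood of `y_*`, `∇ⁿΩ(y_*) = 0`.
>
> **Theorem 3.10.** Let `U` be a nontrivial `C²` smooth globally self-similar velocity profile
> for 3D incompressible Euler equations. Assume that the local outgoing property of Definition 3.7
> holds. Furthermore, assume that `Ω` is real-analytic at all `y_* ∈ 𝒩_V`. Then `γ ≥ ½`.

(Proof in print: Prop. 3.9 and analyticity make `Ω` vanish near `𝒩_V`; by the Bernoulli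
transport identity (3.31) `V·∇ℋ = (2γ−1)|V|²` and the far-field inflow (from the standing decay
(3.8)) every backward Lagrangian trajectory of `V` enters that neighbourhood in finite time;
the self-similar Cauchy formula (3.21) then gives `Ω ≡ 0`, contradicting nontriviality. The
axisymmetric restatement is their **Theorem 4.3 (ii)**.)

## What is here

* `CIV2026_half_le_of_isLocallyOutgoing_of_analyticAt` — **Theorem 3.10** as a named fact, over
  the tree's vocabulary: exponent `γ > 0`, a `C²` profile `IsSelfSimilarEulerProfile γ c U P` with
  the standing far-field bounds (3.8) `HasSelfSimilarFarField γ c U` (they are part of CIV's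
  §3.1 standing assumptions on a "globally self-similar velocity profile" and are USED in the
  printed proof through the radius `R♭`), `U ≠ 0`, the local outgoing property
  `IsLocallyOutgoing γ c U κ ε` (Def. 3.7: finite nodal set, `c_* = κ ≥ 0`, `ε_* = ε > 0`), and
  `AnalyticAt ℝ (curl U) y` at every `y ∈ selfSimilarNodalSet γ c U`; conclusion `½ ≤ γ`.
* PROVED companions (all take the fact as a hypothesis `hfact`): `.of_isGloballyOutgoing`
  (Elgindi's global outgoing property (3.36) ⇒ `𝒩_V ⊆ {c}`, so analyticity is needed at the
  centre only), `.of_analyticAt_or_curl_ne_zero` (the fact is needed only when `Ω` vanishes at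
  EVERY stagnation point — otherwise Theorem 3.8, a tree theorem, already gives `γ ≥ ½`), and the
  window forms `.eq_zero_of_lt_half` / `.eq_zero_of_exponent` (in the Chae–Shvydkoy window
  `γ < ½`, i.e. `γ = 1/(2+ρ)` with `ρ > 0` in the power-gauge exponent of route
  EulerZoomLiouville, an outgoing profile with vorticity analytic at the nodes is trivial).

## Design notes (faithfulness)

* CIV normalise `U(0) = 0` ((3.5), Galilean) and the size of `∇Ω` ((3.6)–(3.7), by the scaling
  symmetry of (3.3)); the statement is invariant under both symmetries (`γ`, the outgoing
  constant `c_*`, finiteness of `𝒩_V` and analyticity are unchanged; the tree keeps a free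
  centre `c`), so they are not hypotheses here. The decay (3.8) IS kept as a hypothesis
  (`HasSelfSimilarFarField`; it forces `U(c) = 0`, `HasSelfSimilarFarFieldWith.apply_center`).
* "Real-analytic at `y_*`" is Mathlib's `AnalyticAt ℝ (curl U) y_*` (convergent power series in a
  neighbourhood); "nontrivial" is `U ≠ 0`.
* The source is an arXiv preprint: the fact carries the `claim … under-review` tag (D-0012),
  as the tree's `CIV2026_collapseExponent_ge_two_fifths` (Thm. 2.1) does.
* NOT here: Proposition 3.9 itself (the infinite-order vanishing; its order-zero case is the
  contrapositive of the tree's Theorem 3.8), Theorem 4.6 (all meridional fixed points isolated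
  and on the axis; Poincaré–Bendixson), Theorem 3.4 (no small profiles; a singular-integral
  bound). Discharging the fact needs the global Lagrangian flow of `V`, (3.31) along it
  (`IsSelfSimilarEulerProfile.fderiv_selfSimilarBernoulli_transport` is in the tree), the inflow
  bound `half_mul_sq_le_inner_transport`, and uniqueness for the linear ODE
  `dΩ/dτ = (∇U − 1)Ω` along trajectories — size L.

## Mathlib / tree search

`lean search 'Thm. 3.10|Prop. 3.9|outgoing.*analytic'`: no declaration; CIV §3.5 Def. 3.7 and
Thm. 3.8 are in `SelfSimilarEulerProfile.lean` / `SelfSimilarEulerOutgoing.lean` (reused, not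
restated). Mathlib: `AnalyticAt`.

## References

* P. Constantin, M. Ignatova, V. Vicol, *On putative self-similarity for incompressible 3D
  Euler*, arXiv:2602.17570 (2026), §3.5 Def. 3.7, Prop. 3.9, Thm. 3.10 (pp. 11–12 of v3), §4.2
  Thm. 4.3 (ii). [ConstantinIgnatovaVicol2026Putative]
-/

noncomputable section

open Set

namespace Literature.Analysis.FluidPDE

/-- **Constantin–Ignatova–Vicol 2026, Theorem 3.10** (arXiv:2602.17570 §3.5, as printed): "Let `U`
be a nontrivial `C²` smooth globally self-similar velocity profile for 3D incompressible Euler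
equations. Assume that the local outgoing property of Definition 3.7 holds. Furthermore, assume
that `Ω` is real-analytic at all `y_* ∈ 𝒩_V`. Then `γ ≥ ½`." Rendered over the tree's CIV
vocabulary with the paper's standing assumptions explicit: `γ > 0`, a `C²` profile
`IsSelfSimilarEulerProfile γ c U P` (eq. (3.3), centre `c`) obeying the far-field bounds (3.8)
(`HasSelfSimilarFarField γ c U`), `U ≠ 0`, the local outgoing property `IsLocallyOutgoing γ c U κ ε`
of the transport field `V = γ(y − c) + U` (finite nodal set `𝒩_V`, `V(y)·(y − y_*) ≥ κ|y − y_*|²`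
for `|y − y_*| ≤ ε` at every `y_* ∈ 𝒩_V`, `κ ≥ 0`, `ε > 0`), and the vorticity `curl U`
real-analytic at every point of `𝒩_V`; then `½ ≤ γ`. (The case where some `y_* ∈ 𝒩_V` has
`curl U y_* ≠ 0` is Theorem 3.8, PROVED in the tree: `half_le_of_isLocallyOutgoing`.)
[claim: ConstantinIgnatovaVicol2026Putative, status: under-review] -/
def CIV2026_half_le_of_isLocallyOutgoing_of_analyticAt : Prop :=
  ∀ ⦃γ : ℝ⦄ (_hγ : 0 < γ) ⦃c : EuclideanSpace ℝ (Fin 3)⦄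
    ⦃U : EuclideanSpace ℝ (Fin 3) → EuclideanSpace ℝ (Fin 3)⦄ ⦃P : EuclideanSpace ℝ (Fin 3) → ℝ⦄
    (_h : IsSelfSimilarEulerProfile γ c U P) (_hfar : HasSelfSimilarFarField γ c U) (_hU : U ≠ 0)
    ⦃κ ε : ℝ⦄ (_hout : IsLocallyOutgoing γ c U κ ε)
    (_han : ∀ y ∈ selfSimilarNodalSet γ c U, AnalyticAt ℝ (curl U) y),
    (1 : ℝ) / 2 ≤ γ

namespace CIV2026_half_le_of_isLocallyOutgoing_of_analyticAt

variable {γ : ℝ} {c : EuclideanSpace ℝ (Fin 3)}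
  {U : EuclideanSpace ℝ (Fin 3) → EuclideanSpace ℝ (Fin 3)} {P : EuclideanSpace ℝ (Fin 3) → ℝ}

/-- **Theorem 3.10 under Elgindi's global outgoing property (3.36)**: then `𝒩_V ⊆ {c}`
(`IsGloballyOutgoing.selfSimilarNodalSet_subset`), so analyticity of the vorticity at the centre
alone suffices (given the fact). [claim: ConstantinIgnatovaVicol2026Putative, status: under-review] -/
theorem of_isGloballyOutgoing (hfact : CIV2026_half_le_of_isLocallyOutgoing_of_analyticAt)
    (hγ : 0 < γ) (h : IsSelfSimilarEulerProfile γ c U P) (hfar : HasSelfSimilarFarField γ c U)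
    (hU : U ≠ 0) {κ : ℝ} (hout : IsGloballyOutgoing γ c U κ)
    (han : AnalyticAt ℝ (curl U) c) : (1 : ℝ) / 2 ≤ γ := by
  refine hfact hγ h hfar hU (hout.isLocallyOutgoing one_pos) fun y hy => ?_
  obtain rfl : y = c := hout.selfSimilarNodalSet_subset hy
  exact han

/-- **Theorems 3.8 and 3.10 together.** Under the local outgoing property, `γ ≥ ½` as soon as at
every stagnation point the vorticity is either NON-ZERO (Theorem 3.8 — proved in the tree, no
fact needed) or real-analytic (Theorem 3.10 — the fact); since the nodal set is finite, either
some node is vortical or all nodes are vorticity-free and analytic. [claim: ConstantinIgnatovaVicol2026Putative, status: under-review] -/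
theorem of_analyticAt_or_curl_ne_zero
    (hfact : CIV2026_half_le_of_isLocallyOutgoing_of_analyticAt) (hγ : 0 < γ)
    (h : IsSelfSimilarEulerProfile γ c U P) (hfar : HasSelfSimilarFarField γ c U) (hU : U ≠ 0)
    {κ ε : ℝ} (hout : IsLocallyOutgoing γ c U κ ε)
    (han : ∀ y ∈ selfSimilarNodalSet γ c U, AnalyticAt ℝ (curl U) y ∨ curl U y ≠ 0) :
    (1 : ℝ) / 2 ≤ γ := by
  by_cases hvort : ∃ y ∈ selfSimilarNodalSet γ c U, curl U y ≠ 0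
  · obtain ⟨y, hy, hΩ⟩ := hvort
    exact h.isSelfSimilarEulerVorticityProfile.half_le_of_isLocallyOutgoing hout hy hΩ
  · push Not at hvort
    refine hfact hγ h hfar hU hout fun y hy => ?_
    rcases han y hy with ha | hne
    · exact ha
    · exact absurd (hvort y hy) hne

/-- **In the Chae–Shvydkoy window `γ < ½` there is no outgoing profile with vorticity analytic at
the stagnation points** (contrapositive of Theorem 3.10, given the fact): such a profile with the
far-field decay (3.8) is trivial, `U = 0`. [claim: ConstantinIgnatovaVicol2026Putative, status: under-review] -/
theorem eq_zero_of_lt_half (hfact : CIV2026_half_le_of_isLocallyOutgoing_of_analyticAt)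
    (hγ : 0 < γ) (hγ' : γ < 1 / 2) (h : IsSelfSimilarEulerProfile γ c U P)
    (hfar : HasSelfSimilarFarField γ c U) {κ ε : ℝ} (hout : IsLocallyOutgoing γ c U κ ε)
    (han : ∀ y ∈ selfSimilarNodalSet γ c U, AnalyticAt ℝ (curl U) y) : U = 0 := by
  by_contra hU
  exact absurd (hfact hγ h hfar hU hout han) (not_le.2 hγ')

/-- **Exponent form of the window statement.** In the power-gauge parametrisation of route
EulerZoomLiouville (length exponent `γ = 1/(2+ρ)`, window `ρ > 0 ⟺ 0 < γ < ½`), an outgoing `C²`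
self-similar Euler profile with the decay (3.8) and vorticity analytic at the stagnation points is
trivial (given the fact). [claim: ConstantinIgnatovaVicol2026Putative, status: under-review] -/
theorem eq_zero_of_exponent (hfact : CIV2026_half_le_of_isLocallyOutgoing_of_analyticAt)
    {ρ : ℝ} (hρ : 0 < ρ) (hγ : γ = 1 / (2 + ρ)) (h : IsSelfSimilarEulerProfile γ c U P)
    (hfar : HasSelfSimilarFarField γ c U) {κ ε : ℝ} (hout : IsLocallyOutgoing γ c U κ ε)
    (han : ∀ y ∈ selfSimilarNodalSet γ c U, AnalyticAt ℝ (curl U) y) : U = 0 := by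
  have h2ρ : (0 : ℝ) < 2 + ρ := by linarith
  refine eq_zero_of_lt_half hfact (hγ ▸ one_div_pos.2 h2ρ) ?_ h hfar hout han
  rw [hγ]
  exact one_div_lt_one_div_of_lt two_pos (by linarith)

end CIV2026_half_le_of_isLocallyOutgoing_of_analyticAt

end Literature.Analysis.FluidPDE

end
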